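import Summits.BirchSwinnertonDyer.BirchSwinnertonDyer.Theorems.AdditiveBranchIMCGordTwoRankZeroOffCaseOneFieldSupplyR0
import Literature.NumberTheory.EllipticCurves.CyclotomicIwasawaMainTheoremIrreducibleBaseChangeProofs
import Literature.NumberTheory.EllipticCurves.NonvanishingTwistsPrescribedRamificationOfHoffsteinLuoProofs
import Literature.NumberTheory.EllipticCurves.HeegnerHypothesisKroneckerProofs
import Literature.NumberTheory.QuadraticFields.FundamentalDiscriminant
import HarnessLib

/-!
# Route K1 `AdditiveBranchIMC` — THE GENUS-FIELD SUPPLY FOR A RANK-ONE CURVE ON CELL (G-ord, `e = 2`), with the root-number engine at the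
# additive prime of (G)-twist type (line machinery of `three_field_road`, crux 19357, pointed at crux `GordTwoRankOne`, 19358; LEAD g12)

FIELD 2 of the three-field road (genus Gross–Zagier + Kolyvagin over a `p`-RAMIFIED field `K″`, `ThreeFieldRowClosed.jointUpperBoundAt_genus`)
takes a rank-one curve, a rank-zero good-ordinary partner `A ≅ (curve)^{(d_{K″})}` and the datum `RamifiedKolyvaginField`; on the line the
rank-one curve is the twist `Wd` of a rank-zero tame-row curve, here it is a rank-one `E` ITSELF (consumer:
`AdditiveBranchIMCGordTwoRankOneTameRowSchneiderFreeBSDp`). §1 Jacobi bookkeeping; §2 `w(E^{(pℓ)}) = w(E)` for the auxiliary primes `ℓ` of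
`exists_ramifiedAt_splitAt_twist_ne_zero_of_rootNumber_twist` (both curves are twists of the good-at-`p` partner `V ≅ E^{(p*)}` by odd prime
discriminants prime to `N_V`, so `rootNumber_quadraticTwist_of_emod_four_eq_one` and quadratic reciprocity decide; no semistability
hypothesis); §3 `exists_genusField_rankOne`: Hoffstein–Luo 1997 through that lemma with the ramified prime `:= p` gives `K″` (`p ∣ d_{K″}`,
every prime of `N_E` other than `p` split, `L(E^{(d_{K″})}, 1) ≠ 0`) and the globally minimal `A ≅ E^{(d_{K″})}` (good ordinary at `p`,
`ρ̄_{A,p}` onto, `≅ E` over `ℚ_ℓ` at the bad `ℓ ≠ p`), a `p`-ramified Kolyvagin datum with a free ramified prime.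
THEOREMS ONLY; no definition, no named fact, no `sorry`; closes no item; BSD is proved for no curve by any of this.
References: [HoffsteinLuo1997] Theorem §1; [MurtyMurty1997] Ch. 6 §1; [AtkinLehner1970] §6; [SilvermanAEC2009] X.5 Cor. 5.4, VII.5.1,
VII.6.1; [GrossLMS1991] §1 (Birch's condition).
-/


set_option linter.dupNamespace false
set_option autoImplicit false
noncomputable section
open scoped Classical NumberTheorySymbols
open NumberField IsDedekindDomain IsDedekindDomain.HeightOneSpectrum Rat.HeightOneSpectrum
open WeierstrassCurve Literature.NumberTheory.EllipticCurves
  Literature.NumberTheory.EllipticCurves.ModularForms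
  Literature.NumberTheory.EllipticCurves.Rank1Residual
  Literature.NumberTheory.EllipticCurves.Rank1Residual.Typed
open Summit.BirchSwinnertonDyer.Rank1Residual
open Summit.BirchSwinnertonDyer.Rank1Residual.Additive
open Summit.BirchSwinnertonDyer.BirchSwinnertonDyer.Theorems
open ThreeFieldRoadSupply

namespace Summit.BirchSwinnertonDyer.BirchSwinnertonDyer.Theorems.GenusFieldRankOne
/-! ### §1 Jacobi-symbol bookkeeping -/

/-- `J(a | b) = 1` as soon as `J(a | r) = 1` for every prime `r ∣ b` (multiplicativity in the lower argument). [folklore] -/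
theorem jacobiSym_eq_one_of_forall_prime (a : ℤ) :
    ∀ b : ℕ, b ≠ 0 → (∀ r : ℕ, r.Prime → r ∣ b → jacobiSym a r = 1) → jacobiSym a b = 1 := by
  intro b
  induction b using Nat.strong_induction_on with
  | _ b ih =>
    intro hb h
    by_cases hb1 : b = 1
    · subst hb1; exact jacobiSym.one_right a
    · obtain ⟨r, hr, hrb⟩ := Nat.exists_prime_and_dvd hb1
      obtain ⟨c, rfl⟩ := hrb
      have hc0 : c ≠ 0 := by rintro rfl; simp at hb
      have hr0 : r ≠ 0 := hr.ne_zero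
      rw [jacobiSym.mul_right' a hr0 hc0, h r hr (dvd_mul_right r c), one_mul]
      refine ih c ?_ hc0 fun s hs hsc ↦ h s hs (hsc.mul_left r)
      have : 1 < r := hr.one_lt
      have : 0 < c := Nat.pos_of_ne_zero hc0
      nlinarith

/-- **The symbol identity behind the engine.** For odd primes `p ≠ ℓ` (`pℓ ≡ 1 (mod 8)`, so `ℓ ≡ p (mod 8)`) and `n ≥ 1` prime to `p` with
`(pℓ / r) = 1` at every odd prime `r ∣ n`: `(−1/ℓ)(n/ℓ) = (−1/p)(n/p)` — the `2`-part by `ℓ ≡ p (8)`, the odd part `m` by quadratic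
reciprocity (`ℓ ≡ p (4)`) and `(ℓ/m) = (p/m)` from `(pℓ/m) = 1`. [folklore] -/
theorem jacobiSym_neg_one_mul_eq_of_mul_emod_eight {p ℓ n : ℕ} (hp : p.Prime) (hℓ : ℓ.Prime) (hp2 : p ≠ 2) (hn : n ≠ 0)
    (hpn : ¬ p ∣ n) (h8 : (p * ℓ) % 8 = 1)
    (hJ : ∀ r : ℕ, r.Prime → r ∣ n → r ≠ 2 → jacobiSym ((p : ℤ) * ℓ) r = 1) :
    J(-1 | ℓ) * J((n : ℤ) | ℓ) = J(-1 | p) * J((n : ℤ) | p) := by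
  have hpodd : Odd p := hp.odd_of_ne_two hp2
  have hℓ2 : ℓ ≠ 2 := by
    rintro rfl
    omega
  have hℓodd : Odd ℓ := hℓ.odd_of_ne_two hℓ2
  have h8' : ℓ % 8 = p % 8 := by
    have hmul : (p * ℓ) % 8 = ((p % 8) * (ℓ % 8)) % 8 := Nat.mul_mod _ _ _
    have hp1 : p % 2 = 1 := Nat.odd_iff.mp hpodd
    have hl1 : ℓ % 2 = 1 := Nat.odd_iff.mp hℓodd
    have hx : p % 8 < 8 := Nat.mod_lt _ (by norm_num)
    have hy : ℓ % 8 < 8 := Nat.mod_lt _ (by norm_num)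
    set x := p % 8 with hx'
    set y := ℓ % 8 with hy'
    have hxodd : x % 2 = 1 := by omega
    have hyodd : y % 2 = 1 := by omega
    interval_cases x <;> interval_cases y <;> omega
  have h4' : ℓ % 4 = p % 4 := by omega
  have hneg : J(-1 | ℓ) = J(-1 | p) := by
    rw [jacobiSym.at_neg_one hℓodd, jacobiSym.at_neg_one hpodd, ZMod.χ₄_nat_mod_four ℓ,
      ZMod.χ₄_nat_mod_four p, h4']
  obtain ⟨k, m, hm, rfl⟩ := Nat.exists_eq_two_pow_mul_odd hn
  have hm0 : m ≠ 0 := by rintro rfl; simp at hn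
  have h2 : J(2 | ℓ) = J(2 | p) := by
    rw [jacobiSym.at_two hℓodd, jacobiSym.at_two hpodd, ZMod.χ₈_nat_mod_eight ℓ,
      ZMod.χ₈_nat_mod_eight p, h8']
  have hJm : jacobiSym ((p : ℤ) * ℓ) m = 1 := by
    refine jacobiSym_eq_one_of_forall_prime _ m hm0 fun r hr hrm ↦ hJ r hr (hrm.mul_left _) ?_
    rintro rfl
    exact (Nat.not_even_iff_odd.mpr hm) (even_iff_two_dvd.mpr hrm)
  have hpm : ¬ p ∣ m := fun h ↦ hpn (h.mul_left _)
  have hPm : J((p : ℤ) | m) = 1 ∨ J((p : ℤ) | m) = -1 :=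
    jacobiSym.eq_one_or_neg_one (by
      rw [Int.gcd_natCast_natCast]; exact (Nat.Prime.coprime_iff_not_dvd hp).mpr hpm)
  have hprod : J((p : ℤ) | m) * J((ℓ : ℤ) | m) = 1 := by rw [← jacobiSym.mul_left]; exact hJm
  have hℓpm : J((ℓ : ℤ) | m) = J((p : ℤ) | m) := by
    rcases hPm with h | h <;> rw [h] at hprod ⊢ <;> linarith
  have hrecℓ : J((m : ℤ) | ℓ) = (-1) ^ (m / 2 * (ℓ / 2)) * J((ℓ : ℤ) | m) :=
    jacobiSym.quadratic_reciprocity hm hℓodd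
  have hrecp : J((m : ℤ) | p) = (-1) ^ (m / 2 * (p / 2)) * J((p : ℤ) | m) :=
    jacobiSym.quadratic_reciprocity hm hpodd
  have hsign : ((-1 : ℤ)) ^ (m / 2 * (ℓ / 2)) = (-1) ^ (m / 2 * (p / 2)) := by
    rw [neg_one_pow_eq_pow_mod_two, neg_one_pow_eq_pow_mod_two (n := m / 2 * (p / 2))]
    have hℓp2 : (ℓ / 2) % 2 = (p / 2) % 2 := by omega
    have : (m / 2 * (ℓ / 2)) % 2 = (m / 2 * (p / 2)) % 2 := by
      rw [Nat.mul_mod, Nat.mul_mod (m / 2) (p / 2), hℓp2]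
    rw [this]
  have hcast : ((2 ^ k * m : ℕ) : ℤ) = (2 : ℤ) ^ k * m := by push_cast; ring
  rw [hneg, hcast, jacobiSym.mul_left, jacobiSym.mul_left, jacobiSym.pow_left, jacobiSym.pow_left, h2,
    hrecℓ, hrecp, hsign, hℓpm]

/-- The odd prime discriminant `ℓ* = (−1)^{(ℓ−1)/2} ℓ` is `≡ 1 (mod 4)`. [folklore] -/
theorem pStar_emod_four {ℓ : ℕ} (hℓ : ℓ.Prime) (hℓ2 : ℓ ≠ 2) : ((-1 : ℤ) ^ (ℓ / 2) * ℓ) % 4 = 1 := by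
  have hodd : ℓ % 2 = 1 := Nat.odd_iff.mp (hℓ.odd_of_ne_two hℓ2)
  rcases Nat.even_or_odd (ℓ / 2) with he | ho
  · rw [he.neg_one_pow, one_mul]
    have : ℓ % 4 = 1 := by obtain ⟨k, hk⟩ := he; omega
    omega
  · rw [ho.neg_one_pow, neg_one_mul]
    have : ℓ % 4 = 3 := by obtain ⟨k, hk⟩ := ho; omega
    omega

/-! ### §2 The root-number engine at the additive prime of (G)-twist type -/

section EngineAndSupply

variable (W : WeierstrassCurve ℚ) [W.IsElliptic] [W.IsGloballyMinimal] (p : ℕ) [hp : Fact p.Prime]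

/-- **`w(E^{(pℓ)}) = w(E)` at the additive prime `p` of cell (G-ord, `e = 2`)** for every auxiliary prime `ℓ ≠ p` of good reduction with
`pℓ ≡ 1 (mod 8)` and `(pℓ / r) = 1` at every odd bad prime `r ≠ p` — the hypothesis `hroot` of
`exists_ramifiedAt_splitAt_twist_ne_zero_of_rootNumber_twist` with the ramified prime `:= p`. Proof: `E ≅ V^{(p*)}` with `V` good ordinary
at `p`, `N_E = N_V p²` (`ThreeFieldRoadSupply.exists_goodOrd_partner_rootNumber`, which also gives `w(E) = (−1/p)(N_V/p) w(V)`);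
`E^{(pℓ)} ≅ V^{(p*·pℓ)} = V^{(ℓ*·p²)} ≅ V^{(ℓ*)}`, so `w(E^{(pℓ)}) = (−1/ℓ)(N_V/ℓ) w(V)` (`rootNumber_quadraticTwist_of_emod_four_eq_one`), and
the two symbol products agree (§1). [cite: MurtyMurty1997, Ch. 6 §1 (functional equation of L_D(s, f))] [cite: AtkinLehner1970, §6]
[cite: SilvermanAEC2009, X.5 Cor. 5.4] -/
theorem rootNumber_quadraticTwist_mul_eq_of_cellGordTwo (hmod : exists_isNewformOf) (hp5 : 5 ≤ p) (hcell : N10.CellGordTwo W p)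
    {ℓ : ℕ} (hℓ : ℓ.Prime) (hpℓ : p ≠ ℓ) (hℓg : (haveI := Fact.mk hℓ; W.HasGoodReductionAtPrime ℓ))
    (h8 : ((p : ℤ) * ℓ) % 8 = 1)
    (hjac : ∀ r : ℕ, r.Prime → r ∣ W.conductorNorm ℤ → r ≠ 2 → r ≠ p → jacobiSym ((p : ℤ) * ℓ) r = 1) :
    (W.quadraticTwist (((p : ℤ) * ℓ : ℤ) : ℚ)).rootNumber = W.rootNumber := by
  haveI : Fact ℓ.Prime := ⟨hℓ⟩
  have hp2 : p ≠ 2 := by omega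
  have h8n : (p * ℓ) % 8 = 1 := by exact_mod_cast h8
  have hℓ2 : ℓ ≠ 2 := by rintro rfl; omega
  obtain ⟨V, iV, iVm, CV, -, hordV, ⟨C', hC'⟩, hcond, hpN, hw⟩ :=
    ThreeFieldRoadSupply.exists_goodOrd_partner_rootNumber W p hmod hp5 hcell
  have hℓNW : ¬ ℓ ∣ W.conductorNorm ℤ := fun h ↦
    ((W.dvd_conductorNorm_iff_not_hasGoodReductionAtPrime ℓ).mp h) hℓg
  have hℓNV : ¬ ℓ ∣ V.conductorNorm ℤ := fun h ↦ hℓNW (by rw [hcond]; exact h.mul_right _)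
  have hNV0 : V.conductorNorm ℤ ≠ 0 := (V.conductorNorm_pos_holds).ne'
  have h4' : ℓ % 4 = p % 4 := by
    have hpodd : p % 2 = 1 := Nat.odd_iff.mp (hp.out.odd_of_ne_two hp2)
    have hlodd : ℓ % 2 = 1 := Nat.odd_iff.mp (hℓ.odd_of_ne_two hℓ2)
    have hmul : (p * ℓ) % 8 = ((p % 8) * (ℓ % 8)) % 8 := Nat.mul_mod _ _ _
    have hx : p % 8 < 8 := Nat.mod_lt _ (by norm_num)
    have hy : ℓ % 8 < 8 := Nat.mod_lt _ (by norm_num)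
    set x := p % 8 with hx'
    set y := ℓ % 8 with hy'
    have hxodd : x % 2 = 1 := by omega
    have hyodd : y % 2 = 1 := by omega
    interval_cases x <;> interval_cases y <;> omega
  have hsgn : ((-1 : ℚ)) ^ (p / 2) = (-1) ^ (ℓ / 2) := by
    rw [neg_one_pow_eq_pow_mod_two, neg_one_pow_eq_pow_mod_two (n := ℓ / 2)]
    have : (p / 2) % 2 = (ℓ / 2) % 2 := by omega
    rw [this]
  set ls : ℤ := (-1 : ℤ) ^ (ℓ / 2) * ℓ with hls
  have hls0 : (ls : ℚ) ≠ 0 := by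
    have : ls ≠ 0 := mul_ne_zero (pow_ne_zero _ (by norm_num)) (by exact_mod_cast hℓ.ne_zero)
    exact_mod_cast this
  have hp0 : (p : ℚ) ≠ 0 := by exact_mod_cast hp.out.ne_zero
  have htw : ∃ Cx : VariableChange ℚ,
      Cx • V.quadraticTwist ((ls : ℚ) * (p : ℚ) ^ 2) = W.quadraticTwist (((p : ℤ) * ℓ : ℤ) : ℚ) := by
    have hprod : ((-1 : ℚ) ^ (p / 2) * p) * ((((p : ℤ) * ℓ : ℤ) : ℚ)) = (ls : ℚ) * (p : ℚ) ^ 2 := by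
      rw [hsgn, hls]; push_cast; ring
    refine ⟨⟨C'.u, ((((p : ℤ) * ℓ : ℤ) : ℚ)) * C'.r, 0, 0⟩, ?_⟩
    rw [← hC', WeierstrassCurve.quadraticTwist_smul, quadraticTwist_quadraticTwist, hprod]
  obtain ⟨Cx, hCx⟩ := htw
  haveI : (V.quadraticTwist ((ls : ℚ) * (p : ℚ) ^ 2)).IsElliptic :=
    V.isElliptic_quadraticTwist (mul_ne_zero hls0 (pow_ne_zero _ hp0))
  have h1 : (W.quadraticTwist (((p : ℤ) * ℓ : ℤ) : ℚ)).rootNumber = (V.quadraticTwist (ls : ℚ)).rootNumber := by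
    rw [← hCx, WeierstrassCurve.rootNumber_smul_holds _ Cx, rootNumber_quadraticTwist_mul_sq V hls0 (p : ℚ) hp0]
  have hls4 : ls % 4 = 1 := pStar_emod_four hℓ hℓ2
  have hlssq : Squarefree ls := squarefree_pStar (p := ℓ)
  have hgcd : Int.gcd ls (V.conductorNorm ℤ) = 1 := by
    rw [Int.gcd_eq_natAbs, hls, natAbs_pStar (p := ℓ)]
    simpa using (Nat.Prime.coprime_iff_not_dvd hℓ).mpr hℓNV
  have h2 := (rootNumber_quadraticTwist_of_emod_four_eq_one V hmod hls4 hlssq hgcd).1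
  rw [hls, natAbs_pStar (p := ℓ)] at h2
  rw [h1, hls, h2, hw]
  have hjacV : ∀ r : ℕ, r.Prime → r ∣ V.conductorNorm ℤ → r ≠ 2 → jacobiSym ((p : ℤ) * ℓ) r = 1 := by
    intro r hr hrV hr2
    refine hjac r hr (by rw [hcond]; exact hrV.mul_right _) hr2 ?_
    rintro rfl
    exact hpN hrV
  rw [jacobiSym_neg_one_mul_eq_of_mul_emod_eight hp.out hℓ hp2 hNV0 hpN h8n hjacV]

/-! ### §3 The genus-field supply for a rank-one curve on cell (G-ord, `e = 2`) -/

open Literature.NumberTheory.QuadraticFields Literature.NumberTheory.EllipticCurves.Castella2018.TamagawaQuadratic in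
/-- **THE GENUS-FIELD SUPPLY FOR A RANK-ONE CURVE.** For `E/ℚ` (globally minimal `W`) with `w(E) = −1`, `(E,p)` on cell (G-ord, `e = 2`),
`p ≥ 5`, `ρ̄_{E,p}` onto, `p ∤ ∏ c_ℓ(E)`, and a multiplicative prime `q ≠ p` with `p ∤ v_q(Δ)`: an imaginary quadratic `K″` with
`p ∣ d_{K″}`, every prime of `N_E` other than `p` split (so `(E, A, K″)` is a `p`-ramified Kolyvagin datum, the Birch clause being vacuous),
a free ramified prime `ℓ ∣ d_{K″}`, `ℓ ∤ pN_E`, and a globally minimal `A ≅ E^{(d_{K″})}` with `r_an(A) = 0` (Hoffstein–Luo through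
`exists_ramifiedAt_splitAt_twist_ne_zero_of_rootNumber_twist` with the ramified prime `:= p`, root numbers by §2), good ordinary at `p`
(a `p`-unit square-free twist of the partner `V`, `isOrdinaryAt_of_smul_eq_quadraticTwist`), `ρ̄_{A,p}` onto, multiplicative at `q` with
`p ∤ v_q(Δ_A)`, and `p ∤ ∏ c_ℓ(A)` (`A ≅ E` over `ℚ_ℓ` at the bad `ℓ ≠ p`; `c ≤ 4` at the other places).
[cite: HoffsteinLuo1997, Theorem (§1, pp. 435–436)] [cite: SilvermanAEC2009, X.5 Cor. 5.4, VII.5.1 and Thm VII.6.1]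
[cite: GrossLMS1991, §1 (Birch's Heegner condition)] -/
theorem exists_genusField_rankOne (hmod : exists_isNewformOf) (hL : hasEntireLFunction_rat)
    (hHL : HoffsteinLuo1997_exists_twist_L_one_ne_zero)
    (hp5 : 5 ≤ p) (hw : W.rootNumber = -1) (hcell : N10.CellGordTwo W p) (hsurj : Surj W p)
    (htam : ¬ p ∣ W.tamagawaProduct)
    {q : ℕ} [hq : Fact q.Prime] (hqp : q ≠ p) (hqm : W.HasMultiplicativeReductionAtPrime q)
    (hqv : ¬ p ∣ padicValInt q W.minimalDiscriminantInt) :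
    ∃ (K'' : Type) (_ : Field K'') (_ : NumberField K'')
      (A : WeierstrassCurve ℚ) (_ : A.IsElliptic) (_ : A.IsGloballyMinimal),
      RamifiedKolyvaginField W A p K'' ∧
      (∃ ℓ : ℕ, ℓ.Prime ∧ (ℓ : ℤ) ∣ NumberField.discr K'' ∧ ℓ ≠ p ∧ ¬ ℓ ∣ W.conductorNorm ℤ) ∧
      (∃ C : VariableChange ℚ, C • W.quadraticTwist (NumberField.discr K'' : ℚ) = A) ∧
      A.analyticRank = 0 ∧ GoodOrd A p ∧ Surj A p ∧
      (∃ ℓ : ℕ, ∃ _ : Fact ℓ.Prime, ℓ ≠ p ∧ A.HasMultiplicativeReductionAtPrime ℓ ∧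
        ¬ p ∣ padicValInt ℓ A.minimalDiscriminantInt) ∧
      ¬ p ∣ A.tamagawaProduct := by
  have hp2 : p ≠ 2 := by omega
  have hp0 : (p : ℚ) ≠ 0 := by exact_mod_cast hp.out.ne_zero
  have hN0 : W.conductorNorm ℤ ≠ 0 := (W.conductorNorm_pos_holds).ne'
  obtain ⟨K'', iF, iN, hK, hB, hpD, hsplit, h2, -, hLne⟩ :=
    exists_ramifiedAt_splitAt_twist_ne_zero_of_rootNumber_twist W hmod hHL hw p hp2
      (fun ℓ hℓ _ hlt hℓg h8 hj ↦
        rootNumber_quadraticTwist_mul_eq_of_cellGordTwo W p hmod hp5 hcell hℓ (Nat.ne_of_lt hlt) hℓg h8 hj)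
      q hq.out hqp p
  have h2K : Module.finrank ℚ K'' = 2 := hK.1
  have hDneg : NumberField.discr K'' < 0 := hK.discr_neg
  have h2split : ((Ideal.span {(2 : ℤ)}).primesOver (𝓞 K'')).ncard = 2 := by
    by_cases h2N : 2 ∣ W.conductorNorm ℤ
    · exact hsplit 2 Nat.prime_two h2N (fun h ↦ hp2 h.symm)
    · exact h2 h2N
  have hHeeg : ∀ ℓ : ℕ, ℓ.Prime → ℓ ∣ W.conductorNorm ℤ → ℓ ≠ p → SatisfiesHeegnerHypothesis ℓ K'' := by
    intro ℓ hℓ hℓN hℓp r hr hrℓ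
    obtain rfl : r = ℓ := (Nat.prime_dvd_prime_iff_eq hr hℓ).mp hrℓ
    exact hsplit r hr hℓN hℓp
  have hHeeg2 : SatisfiesHeegnerHypothesis 2 K'' := fun r hr hr2 ↦ by
    obtain rfl : r = 2 := (Nat.prime_dvd_prime_iff_eq hr Nat.prime_two).mp hr2
    exact h2split
  have hD8 : NumberField.discr K'' % 8 = 1 :=
    ((satisfiesHeegnerHypothesis_iff_kronecker 2 K'' h2K).mp hHeeg2 2 Nat.prime_two dvd_rfl).1 rfl
  have hD4 : NumberField.discr K'' % 4 = 1 := by omega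
  have hDsq : Squarefree (NumberField.discr K'') := by
    rcases Quadratic.isFundamentalDiscriminant_discr (K := K'') h2K with ⟨-, hsq, -⟩ | ⟨h4, -, -⟩
    · exact hsq
    · exfalso; obtain ⟨k, hk⟩ := h4; omega
  have hD1 : NumberField.discr K'' ≠ 1 := by omega
  have hD0 : NumberField.discr K'' ≠ 0 := by omega
  have hDq : ((NumberField.discr K'' : ℤ) : ℚ) ≠ 0 := by exact_mod_cast hD0
  have hkr : ∀ ℓ : ℕ, ℓ.Prime → ℓ ∣ W.conductorNorm ℤ → ℓ ≠ p →
      (ℓ = 2 → NumberField.discr K'' % 8 = 1) ∧ (ℓ ≠ 2 → jacobiSym (NumberField.discr K'') ℓ = 1) :=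
    fun ℓ hℓ hℓN hℓp ↦ (satisfiesHeegnerHypothesis_iff_kronecker ℓ K'' h2K).mp (hHeeg ℓ hℓ hℓN hℓp) ℓ hℓ dvd_rfl
  have hsqD : ∀ ℓ : ℕ, (hℓ : ℓ.Prime) → ℓ ∣ W.conductorNorm ℤ → ℓ ≠ p →
      (haveI : Fact ℓ.Prime := ⟨hℓ⟩; IsSquare (((NumberField.discr K'' : ℤ) : ℚ) : ℚ_[ℓ])) := by
    intro ℓ hℓ hℓN hℓp
    haveI : Fact ℓ.Prime := ⟨hℓ⟩
    exact isSquare_padic_of_fundamental hD4 hDsq hD1 (hkr ℓ hℓ hℓN hℓp)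
  have hndvd : ∀ ℓ : ℕ, ℓ.Prime → ℓ ∣ W.conductorNorm ℤ → ℓ ≠ p → ¬ (ℓ : ℤ) ∣ NumberField.discr K'' := by
    intro ℓ hℓ hℓN hℓp hℓD
    by_cases hℓ2 : ℓ = 2
    · subst hℓ2
      obtain ⟨k, hk⟩ := hℓD
      omega
    · have h1 := (hkr ℓ hℓ hℓN hℓp).2 hℓ2
      rw [jacobiSym.mod_left, Int.emod_eq_zero_of_dvd hℓD, jacobiSym.zero_left hℓ.one_lt] at h1
      exact zero_ne_one h1
  obtain ⟨m, hm⟩ := hpD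
  have hpD' : (p : ℤ) ∣ NumberField.discr K'' := ⟨m, hm⟩
  have hpm : ¬ (p : ℤ) ∣ m := by
    rintro ⟨k, rfl⟩
    have hu := hDsq (p : ℤ) ⟨k, by rw [hm]; ring⟩
    rcases Int.isUnit_iff.mp hu with h | h <;> omega
  have hfree : ∃ ℓ : ℕ, ℓ.Prime ∧ (ℓ : ℤ) ∣ NumberField.discr K'' ∧ ℓ ≠ p ∧ ¬ ℓ ∣ W.conductorNorm ℤ := by
    have habs : (NumberField.discr K'').natAbs = p * m.natAbs := by
      rw [hm, Int.natAbs_mul, Int.natAbs_natCast]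
    have hm1 : m.natAbs ≠ 1 := by
      intro h1
      have hB' := hB
      rw [habs, h1, mul_one] at hB'
      exact lt_irrefl _ hB'
    obtain ⟨r, hr, hrm⟩ := Nat.exists_prime_and_dvd hm1
    have hrm' : (r : ℤ) ∣ m := Int.natCast_dvd.mpr hrm
    have hrD : (r : ℤ) ∣ NumberField.discr K'' := by rw [hm]; exact hrm'.mul_left _
    have hrp : r ≠ p := by
      rintro rfl
      exact hpm hrm'
    exact ⟨r, hr, hrD, hrp, fun hrN ↦ hndvd r hr hrN hrp hrD⟩
  obtain ⟨A, iA, iAm, CA, hCA⟩ := exists_isGloballyMinimal_smul_eq_quadraticTwist W hDq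
  have hA : CA⁻¹ • W.quadraticTwist ((NumberField.discr K'' : ℤ) : ℚ) = A := by rw [← hCA, inv_smul_smul]
  have hrA : A.analyticRank = 0 := analyticRank_eq_zero_tameTwist W K'' hL CA⁻¹ hA hLne
  have hsurjA : Surj A p := surj_tameTwist W p K'' CA⁻¹ hA hsurj
  obtain ⟨V, iV, iVm, CV, -, hordV, ⟨C', hC'⟩, hcond, hpN, -⟩ :=
    ThreeFieldRoadSupply.exists_goodOrd_partner_rootNumber W p hmod hp5 hcell
  have hmsq : Squarefree m := hDsq.squarefree_of_dvd ⟨p, by rw [hm]; ring⟩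
  have htsq : Squarefree ((-1 : ℤ) ^ (p / 2) * m) := by
    rcases neg_one_pow_eq_or ℤ (p / 2) with h | h <;> rw [h]
    · simpa using hmsq
    · simpa using hmsq.squarefree_of_dvd (neg_dvd.mpr (dvd_refl m))
  have hpt : ¬ (p : ℤ) ∣ (-1 : ℤ) ^ (p / 2) * m := by
    intro h
    apply hpm
    rcases neg_one_pow_eq_or ℤ (p / 2) with h1 | h1 <;> rw [h1] at h <;> simpa using h
  have hgoA : GoodOrd A p := by
    obtain ⟨Cy, hCy⟩ := V.exists_variableChange_quadraticTwist_mul_sq ((((-1 : ℤ) ^ (p / 2) * m : ℤ) : ℚ)) (p : ℚ) hp0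
    have hprod : ((-1 : ℚ) ^ (p / 2) * p) * ((NumberField.discr K'' : ℤ) : ℚ) =
        ((((-1 : ℤ) ^ (p / 2) * m : ℤ) : ℚ)) * (p : ℚ) ^ 2 := by
      rw [hm]; push_cast; ring
    have hAeq : A = (CA⁻¹ * ⟨C'.u, ((NumberField.discr K'' : ℤ) : ℚ) * C'.r, 0, 0⟩ * Cy) •
        V.quadraticTwist ((((-1 : ℤ) ^ (p / 2) * m : ℤ) : ℚ)) := by
      rw [← hA, ← hC', WeierstrassCurve.quadraticTwist_smul, quadraticTwist_quadraticTwist, hprod, ← hCy, smul_smul,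
        smul_smul]
    have hC₁ : (CA⁻¹ * ⟨C'.u, ((NumberField.discr K'' : ℤ) : ℚ) * C'.r, 0, 0⟩ * Cy)⁻¹ • A =
        V.quadraticTwist ((((-1 : ℤ) ^ (p / 2) * m : ℤ) : ℚ)) := by
      rw [hAeq, inv_smul_smul]
    have hord := isOrdinaryAt_of_smul_eq_quadraticTwist V A htsq hC₁ p hp2 hpt ⟨hordV.1, hordV.2⟩
    exact ⟨hord.1, hord.2⟩
  have hqN : q ∣ W.conductorNorm ℤ :=
    (W.dvd_conductorNorm_iff_not_hasGoodReductionAtPrime q).mpr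
      (not_hasGoodReductionAtPrime_of_hasMultiplicativeReductionAtPrime q hqm)
  have hsqq : IsSquare (((NumberField.discr K'' : ℤ) : ℚ) : ℚ_[q]) := hsqD q hq.out hqN hqp
  have hmultA : A.HasMultiplicativeReductionAtPrime q := (X11b.mult_iff_of_twist W hDq hsqq A hA).mpr hqm
  have hΔq : padicValInt q A.minimalDiscriminantInt = padicValInt q W.minimalDiscriminantInt :=
    X11b.padicValInt_minimalDiscriminantInt_twist_eq W q hDq (by simpa using hsqq) CA⁻¹ hA
  have hjA : A.j = W.j := AdditivePotMult.j_of_model_twist hDq ⟨CA⁻¹, hA⟩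
  have htamA : ¬ p ∣ A.tamagawaProduct := by
    refine not_dvd_tamagawaProduct_of_forall A p fun v ↦ ?_
    set ℓ : ℕ := (primesEquiv v : ℕ) with hℓdef
    haveI hℓF : Fact ℓ.Prime := ⟨(primesEquiv v).2⟩
    by_cases hcase : ℓ ∣ W.conductorNorm ℤ ∧ ℓ ≠ p
    · rw [localTamagawaNumber_eq_of_twist_of_isSquare W v (ℓ := ℓ) rfl hDq
        (hsqD ℓ hℓF.out hcase.1 hcase.2) A hA]
      intro hdvd
      apply htam
      set cW : HeightOneSpectrum (𝓞 ℚ) → ℕ := fun v =>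
        (W.baseChange (v.adicCompletion ℚ)).localTamagawaNumber (v.adicCompletionIntegers ℚ) with hcW
      have hfin : (Function.mulSupport cW).Finite := W.mulSupport_localTamagawaNumber_finite_holds
      rw [show W.tamagawaProduct = ∏ᶠ v, cW v from rfl,
        finprod_eq_prod_of_mulSupport_subset cW (s := hfin.toFinset) (by simp)]
      by_cases hv1 : cW v = 1
      · exfalso
        have : p ∣ 1 := by rw [← hv1]; exact hdvd
        exact hp.out.ne_one (Nat.dvd_one.mp this)
      · exact hdvd.trans (Finset.dvd_prod_of_mem cW (hfin.mem_toFinset.mpr hv1))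
    · obtain ⟨h1, -, h4⟩ := kodairaNeron_localTamagawaNumber A v
      have hns : ¬ A.HasSplitMultiplicativeReductionAt v := by
        intro hsplitv
        have hmult := hsplitv.hasMultiplicativeReductionAt
        have hlt := one_lt_valuation_j v A hmult
        have hle : v.valuation ℚ A.j ≤ 1 := by
          by_cases hℓp : ℓ = p
          · refine Additive.valuation_j_le_one_of_hasGoodReductionAt A v ?_
            refine (hasGoodReductionAtPrime_iff_hasGoodReductionAt_ringOfIntegers v A).mp ?_
            have hg : A.HasGoodReductionAtPrime p := hgoA.1
            have key : ∀ (n : ℕ) (i₁ : Fact n.Prime) (i₂ : Fact p.Prime), n = p →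
                @HasGoodReductionAtPrime A p i₂ → @HasGoodReductionAtPrime A n i₁ := by
              rintro n i₁ i₂ rfl h; exact h
            exact key _ _ _ hℓp hg
          · have hℓN : ¬ ℓ ∣ W.conductorNorm ℤ := fun h ↦ hcase ⟨h, hℓp⟩
            have hgood : W.HasGoodReductionAtPrime ℓ :=
              not_not.mp (mt (W.dvd_conductorNorm_iff_not_hasGoodReductionAtPrime ℓ).mpr hℓN)
            rw [hjA]
            exact Additive.valuation_j_le_one_of_hasGoodReductionAt W v
              ((hasGoodReductionAtPrime_iff_hasGoodReductionAt_ringOfIntegers v W).mp hgood)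
        exact (not_lt.mpr hle) hlt
      have hc4 := h4 hns
      intro hdvd
      have := Nat.le_of_dvd (by omega) hdvd
      omega
  refine ⟨K'', iF, iN, A, iA, iAm, ⟨hK, hpD', ?_, ?_⟩, hfree, ⟨CA⁻¹, hA⟩, hrA, hgoA, hsurjA,
    ⟨q, hq, hqp, hmultA, by rw [hΔq]; exact hqv⟩, htamA⟩
  · -- every prime of `N_E` off `d_{K''}` splits
    intro ℓ hℓ hℓN hℓD
    have hℓp : ℓ ≠ p := by rintro rfl; exact hℓD hpD'
    exact hHeeg ℓ hℓ hℓN hℓp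
  · -- Birch's clause is vacuous: no prime of `N_E` other than `p` divides `d_{K''}`
    intro ℓ hℓ hℓN hℓD hℓp
    exact absurd hℓD (hndvd ℓ hℓ hℓN hℓp)

end EngineAndSupply

end Summit.BirchSwinnertonDyer.BirchSwinnertonDyer.Theorems.GenusFieldRankOne

end
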